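import Literature.MathematicalPhysics.QuantumFieldTheory.YangMillsOS
import Literature.MathematicalPhysics.QuantumLattice.LatticeGaugeDLRGibbsProofs
import Literature.MathematicalPhysics.QuantumFieldTheory.LatticeGaugeProofs
import Literature.MathematicalPhysics.QuantumFieldTheory.BalabanBlockSpecification
import Literature.Probability.LatticeModels.TorusCentredLift

/-!
# Stub `stub_lower` of line `dlr-collar-transfer` (crux `OSLegsFromFemtoAndGap`, stmt-QuantumFields-9367):
# auxiliary file 1 — the one-region torus DLR step in window form

Helpers for `Summits/QuantumFields/YangMills/Theorems/LangevinControlUVOSLegsFromFemtoAndGapStubLower.lean`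
that mention only tree (`Literature`) notions:

* `injOn_torusProj_of_window`: reduction mod `T` is injective on a set of sites lying in a
  half-open window of width `T`;
* `exists_near_of_mem_plaquetteEdges_touching`: an edge of a plaquette touching `Λ` is within
  sup-distance `1` of an edge of `Λ`;
* `integral_torusLift_eq_integral_kernel`: the torus DLR identity
  `∫ F ∘ lift dμ_T = ∫ (γ_Λ F) ∘ lift dμ_T` of the tree
  (`wilsonExpectation_toTorusObservable_eq`) with its injectivity hypothesis replaced by the
  checkable window condition "all base points of `Λ ∪ supp F` lie, with margin one, in a window
  of width `T`";
* cylinder/continuity/boundedness facts for the translated action density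
  `U ↦ r.curvature.F (configShift (-z) U)` of a `LatticeRep` (second countability of `G` is the
  tree's `LatticeRep.secondCountableTopology`).

Refs: Georgii 2011 Thm. 4.17 (4.18); Friedli–Velenik 2017 (6.34); Seiler LNP 159 Ch. 2.
-/

set_option autoImplicit false

noncomputable section

open MeasureTheory Filter Topology
open Literature.MathematicalPhysics.QuantumFieldTheory Literature.MathematicalPhysics.QuantumLattice
open Literature.Probability.LatticeModels

namespace Summit.QuantumFields.YangMills.Theorems.OSLegsFromFemtoAndGap.StubLower

/-! ### Windows and injectivity of the reduction mod `T` -/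

/-- Reduction mod `T` is injective on a set of sites of `ℤᵈ` contained in a half-open coordinate
window `∏ⱼ [lo j, lo j + T)`. [folklore] -/
theorem injOn_torusProj_of_window {d : ℕ} (T : ℕ) (lo : Fin d → ℤ) {B : Set (Site d)}
    (hB : ∀ z ∈ B, ∀ j, lo j ≤ z j ∧ z j < lo j + T) : Set.InjOn (Torus.proj T) B := by
  intro z hz z' hz' h
  refine Torus.proj_injective_of_abs_sub_lt (fun j => ?_) h
  have h1 := hB z hz j
  have h2 := hB z' hz' j
  rw [abs_lt]
  constructor <;> linarith

/-- An edge of a plaquette touching `Λ` is within sup-distance one (on base points) of an edge of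
`Λ` (the Wilson interaction has range one). [folklore] -/
theorem exists_near_of_mem_plaquetteEdges_touching {d : ℕ}
    {Λ : Finset (Literature.MathematicalPhysics.QuantumLattice.ZdEdge d)}
    {e : Literature.MathematicalPhysics.QuantumLattice.ZdEdge d}
    (he : e ∈ (plaquettesTouching Λ).biUnion plaquetteEdges) :
    ∃ e' ∈ Λ, ∀ j, e'.1 j - 1 ≤ e.1 j ∧ e.1 j ≤ e'.1 j + 1 := by
  classical
  obtain ⟨p, hp, hep⟩ := Finset.mem_biUnion.1 he
  obtain ⟨e', he'⟩ := mem_plaquettesTouching_iff.1 hp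
  obtain ⟨he'p, he'Λ⟩ := Finset.mem_inter.1 he'
  refine ⟨e', he'Λ, fun j => ?_⟩
  have hs : ∀ i : Fin d, (Pi.single i (1 : ℤ) : Fin d → ℤ) j = 0 ∨
      (Pi.single i (1 : ℤ) : Fin d → ℤ) j = 1 := fun i => by
    rcases eq_or_ne j i with rfl | hji
    · exact Or.inr (by simp)
    · exact Or.inl (by simp [Pi.single_eq_of_ne hji])
  simp only [plaquetteEdges, Finset.mem_insert, Finset.mem_singleton] at hep he'p
  have key : ∀ u w : Literature.MathematicalPhysics.QuantumLattice.ZdEdge d,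
      (u = (p.1, p.2.1.1) ∨ u = (p.1 + Pi.single p.2.1.1 1, p.2.1.2) ∨
      u = (p.1 + Pi.single p.2.1.2 1, p.2.1.1) ∨ u = (p.1, p.2.1.2)) →
      p.1 j ≤ u.1 j ∧ u.1 j ≤ p.1 j + 1 := by
    intro u w hu
    rcases hu with rfl | rfl | rfl | rfl
    · exact ⟨le_rfl, by linarith⟩
    · rcases hs p.2.1.1 with h | h <;> simp only [Pi.add_apply, h] <;> constructor <;> linarith
    · rcases hs p.2.1.2 with h | h <;> simp only [Pi.add_apply, h] <;> constructor <;> linarith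
    · exact ⟨le_rfl, by linarith⟩
  have h1 := key e e hep
  have h2 := key e' e' he'p
  constructor <;> linarith [h1.1, h1.2, h2.1, h2.2]

/-! ### The one-region DLR step on the torus, window form -/

section DLR

variable {G : Type*} [Group G] [TopologicalSpace G] [IsTopologicalGroup G] [CompactSpace G]
  [MeasurableSpace G] [BorelSpace G] [SecondCountableTopology G] {N : ℕ}
  (ρ : G →* Matrix (Fin N) (Fin N) ℂ)

/-- **Torus DLR step, window form** (from the tree's `wilsonExpectation_toTorusObservable_eq`):
for a bounded continuous cylinder observable `F` with support `S₀` and a finite edge set `Λ` such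
that every base point of `Λ ∪ S₀` lies, with margin one, in a coordinate window of width `T`, the
torus Wilson state of side `T` gives the same expectation to `F ∘ torusLift` and to
`(γ_Λ F) ∘ torusLift`, `γ_Λ` the lattice Yang–Mills kernel `ymSpecification` (Georgii 2011,
(4.18); Friedli–Velenik 2017, (6.34)). [folklore] -/
theorem integral_torusLift_eq_integral_kernel {d : ℕ} (hρ : Continuous ρ) (β : ℝ)
    (Λ : Finset (Literature.MathematicalPhysics.QuantumLattice.ZdEdge d)) {F : LGConfig d G → ℝ}
    (hF : Continuous F) {C : ℝ} (hC : ∀ U, |F U| ≤ C)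
    {S₀ : Finset (Literature.MathematicalPhysics.QuantumLattice.ZdEdge d)} (hFS : IsCylinder F S₀)
    (T : ℕ) [NeZero T]
    (lo : Fin d → ℤ)
    (hwin : ∀ e ∈ Λ ∪ S₀, ∀ j, lo j + 1 ≤ e.1 j ∧ e.1 j + 2 ≤ lo j + T) :
    ∫ U, F (torusLift T U) ∂(wilsonMeasure (d := d) (L := T) ρ β) =
      ∫ U, (∫ V, F V ∂(ymSpecification ρ β Λ (torusLift T U)))
        ∂(wilsonMeasure (d := d) (L := T) ρ β) := by
  have h := wilsonExpectation_toTorusObservable_eq ρ hρ β Λ hF hC hFS (L := T) ?_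
  · simpa only [wilsonExpectation, toTorusObservable, Function.comp_def] using h
  refine injOn_torusProj_of_window T lo fun z hz j => ?_
  obtain ⟨e, he, rfl⟩ := Finset.mem_image.1 (Finset.mem_coe.1 hz)
  rcases Finset.mem_union.1 he with he1 | he2
  · have := hwin e he1 j
    constructor <;> linarith
  · obtain ⟨e', he'Λ, hnear⟩ := exists_near_of_mem_plaquetteEdges_touching he2
    have := hwin e' (Finset.mem_union_left _ he'Λ) j
    have h' := hnear j
    constructor <;> linarith

end DLR

/-! ### The translated action density of a `LatticeRep` -/

section Density

variable {G : Type} [Group G] [TopologicalSpace G] [IsTopologicalGroup G] [CompactSpace G]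
  [MeasurableSpace G] [BorelSpace G]

/-- The edges read by the curvature species sit at the origin: base points in `{0, 1}ᵈ`-window. [folklore] -/
theorem curvature_supp_window (r : LatticeRep G) (e : Literature.MathematicalPhysics.QuantumLattice.ZdEdge 4)
    (he : e ∈ r.curvature.supp) (j : Fin 4) :
    0 ≤ e.1 j ∧ e.1 j ≤ 1 := by
  have hs : ∀ i : Fin 4, (Pi.single i (1 : ℤ) : Fin 4 → ℤ) j = 0 ∨
      (Pi.single i (1 : ℤ) : Fin 4 → ℤ) j = 1 := fun i => by
    rcases eq_or_ne j i with rfl | hji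
    · exact Or.inr (by simp)
    · exact Or.inl (by simp [Pi.single_eq_of_ne hji])
  simp only [LatticeRep.curvature, Finset.mem_biUnion, Finset.mem_univ, true_and,
    originPlaquetteSupport, Finset.mem_insert, Finset.mem_singleton] at he
  obtain ⟨q, hq⟩ := he
  rcases hq with rfl | rfl | rfl | rfl
  · simp
  · rcases hs q.1 with h | h <;> simp [h]
  · rcases hs q.2 with h | h <;> simp [h]
  · simp

/-- The action density translated to the site `z` is a cylinder observable on the translated
support, whose base points lie in the window `z + {0,1}ᵈ`. [folklore] -/
theorem isCylinder_curvature_shift (r : LatticeRep G) (z : Site 4) :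
    IsCylinder (fun U : LGConfig 4 G => r.curvature.F (configShift (-z) U))
      (r.curvature.supp.image fun e => (e.1 + z, e.2)) := by
  have h := IsCylinder.comp_configShift r.curvature.isCylinder (-z)
  simp only [sub_neg_eq_add] at h
  exact h

/-- Base points of the translated support lie in `∏ⱼ [z j, z j + 1]`. [folklore] -/
theorem curvature_shift_supp_window (r : LatticeRep G) (z : Site 4)
    (e : Literature.MathematicalPhysics.QuantumLattice.ZdEdge 4)
    (he : e ∈ r.curvature.supp.image fun e => (e.1 + z, e.2)) (j : Fin 4) :
    z j ≤ e.1 j ∧ e.1 j ≤ z j + 1 := by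
  obtain ⟨e', he', rfl⟩ := Finset.mem_image.1 he
  have := curvature_supp_window r e' he' j
  simp only [Pi.add_apply]
  constructor <;> linarith [this.1, this.2]

/-- The translated action density is continuous. [folklore] -/
theorem continuous_curvature_shift (r : LatticeRep G) (z : Site 4) :
    Continuous fun U : LGConfig 4 G => r.curvature.F (configShift (-z) U) :=
  (continuous_actionDensity r.continuous).comp (continuous_configShift (-z))

/-- The action density is bounded (uniformly in the translation). [folklore] -/
theorem exists_abs_curvature_le (r : LatticeRep G) : ∃ C : ℝ, 0 ≤ C ∧ ∀ (z : Site 4) (U : LGConfig 4 G),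
    |r.curvature.F (configShift (-z) U)| ≤ C := by
  obtain ⟨C, hC⟩ := r.curvature.bounded
  exact ⟨max C 0, le_max_right _ _, fun z U => (hC _).trans (le_max_left _ _)⟩

end Density

end Summit.QuantumFields.YangMills.Theorems.OSLegsFromFemtoAndGap.StubLower

end
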